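import Literature.Analysis.FunctionSpaces.LatticeSobolev
import Literature.Analysis.FunctionSpaces.TorusSobolevNormSmoothProofs
import Literature.Analysis.FunctionSpaces.TorusFourierSeries
import HarnessLib

/-!
# The Sobolev scale on the frequency lattice `ℤ^d`, part Id: `⋂_s H_s` = rapidly decreasing =
# smooth (Warner 6.22), truncations

Continuation of `LatticeSobolev.lean`. Warner's Sobolev lemma (GTM 94 (1983), 6.22 and its
Corollary (a), p. 236: an element of `H_t` for all `t` "corresponds to a function of class `C^∞`")
is proved by `∑_{|ξ|<N} |u_ξ| ≤ (∑ (1+|ξ|²)^{-t})^{1/2} ‖u‖_t`. In the tree the dictionary between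
smooth functions on `T^d` and rapidly decreasing coefficient families is already available
(`Torus.RapidDecay`, `Torus.fourierSynth`, `Torus.RapidDecay.isSmooth_fourierSynth`,
`Torus.IsSmooth.rapidDecay_mFourierCoeff` of `TorusFourierSynthesis`; `Torus.IsSmooth.memSobolev_holds` of
`TorusSobolevNormSmoothProofs`), so the Sobolev lemma takes
the form of the equivalence

  `(∀ m, ‖c‖_m < ∞) ↔ RapidDecay c`

(`Lattice.rapidDecay_iff_forall_eNormSq_lt_top`): from right to left `(1+|k|²)^m‖c k‖² ≤
B (1+|k|²)^m ‖c k‖`; from left to right `(1+|k|²)^m ‖c k‖ = (1+|k|²)^{-r}·(1+|k|²)^{m+r}‖c k‖ ≤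
(1+|k|²)^{-2r} + (1+|k|²)^{2(m+r)}‖c k‖²` with `r = #d`, both summable (the lattice sum
`∑ (1+|k|²)^{-#d} < ∞` is the tree's `Torus.summable_inv_one_add_freqNormSq_pow_card`). Hence a
family lying in every `H_m` is the coefficient family of a smooth function
(`Lattice.exists_isSmooth_of_forall_eNormSq_lt_top`), and the coefficients of a smooth function lie
in every `H_s` (`Torus.IsSmooth.eNormSq_mFourierCoeff_lt_top`).

The second part records the **truncations** `Lattice.trunc K c = 𝟙_K · c` to a finite set of modes
(Warner 6.20 (1), and the density of `𝒫` in `H_s`, 6.18 (c)): finite support, rapid decay, the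
norm of a truncation as a finite sum, and `‖c - 𝟙_K c‖²_s → 0` along `K → ℤ^d` for `c ∈ H_s`.

## References

* F. W. Warner, *Foundations of Differentiable Manifolds and Lie Groups*, GTM 94 (1983), 6.18 (c),
  6.20 (1), 6.22 (Sobolev lemma) and Corollary (a). [WarnerGTM94]
* L. Grafakos, *Classical Fourier Analysis*, 3rd ed. (2014), Thm. 3.3.9, Prop. 3.2.5.
-/

open Filter
open scoped ENNReal NNReal Topology

noncomputable section

namespace Literature.Analysis.FunctionSpaces

namespace Lattice

open Torus

variable {d : Type*} [Fintype d]
variable {V : Type*} [NormedAddCommGroup V]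

/-! ### Real summability out of a finite `H_s` norm -/

/-- The terms of `‖c‖²_s`, read back in `ℝ`: `(⟨k⟩^{2s} ‖c k‖²)`. [folklore] -/
theorem toReal_term (s : ℝ) (c : (d → ℤ) → V) (k : d → ℤ) :
    (ENNReal.ofReal (sobolevWeight s k ^ 2) * ‖c k‖ₑ ^ 2).toReal = sobolevWeight s k ^ 2 * ‖c k‖ ^ 2 := by
  rw [ENNReal.toReal_mul, ENNReal.toReal_ofReal (sq_nonneg _), ← ofReal_norm,
    ← ENNReal.ofReal_pow (norm_nonneg _), ENNReal.toReal_ofReal (sq_nonneg _)]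

/-- A finite `H_s` norm is a convergent real series: `∑_k ⟨k⟩^{2s} ‖c k‖² < ∞`. [folklore] -/
theorem summable_of_eNormSq_lt_top {s : ℝ} {c : (d → ℤ) → V} (h : eNormSq s c < ∞) :
    Summable fun k => sobolevWeight s k ^ 2 * ‖c k‖ ^ 2 := by
  have := ENNReal.summable_toReal (f := fun k => ENNReal.ofReal (sobolevWeight s k ^ 2) * ‖c k‖ₑ ^ 2)
    h.ne
  simpa only [toReal_term] using this

/-- Conversely a convergent real series gives a finite norm. [folklore] -/
theorem eNormSq_lt_top_of_summable {s : ℝ} {c : (d → ℤ) → V}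
    (h : Summable fun k => sobolevWeight s k ^ 2 * ‖c k‖ ^ 2) : eNormSq s c < ∞ := by
  have heq : eNormSq s c = ∑' k, ENNReal.ofReal (sobolevWeight s k ^ 2 * ‖c k‖ ^ 2) := by
    refine tsum_congr fun k => ?_
    rw [ENNReal.ofReal_mul (sq_nonneg _), ← ofReal_norm, ENNReal.ofReal_pow (norm_nonneg _)]
  rw [heq, ← ENNReal.ofReal_tsum_of_nonneg (fun k => by positivity) h]
  exact ENNReal.ofReal_lt_top

/-! ### `⋂_m H_m` = rapidly decreasing families (Warner 6.22) -/

section Smooth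

/-- A rapidly decreasing family is bounded: `‖c k‖ ≤ ∑_l ‖c l‖`. [folklore] -/
theorem _root_.Literature.Analysis.FunctionSpaces.Torus.RapidDecay.norm_le_tsum {c : (d → ℤ) → V}
    (hc : RapidDecay c) (k : d → ℤ) : ‖c k‖ ≤ ∑' l, ‖c l‖ :=
  hc.summable_norm.le_tsum k fun _ _ => norm_nonneg _

/-- **Rapidly decreasing families lie in every `H_s`** (the easy half of the Sobolev lemma; for
the coefficients of a smooth function this is Warner's "`𝒫 ⊂ H_s` for each `s`", 6.17/6.18 (c)):
`⟨k⟩^{2s}‖c k‖² ≤ (1+|k|²)^m ‖c k‖ · sup ‖c‖` for `m ≥ s`. [cite: WarnerGTM94, 6.18 (c)] -/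
theorem eNormSq_lt_top_of_rapidDecay {c : (d → ℤ) → V} (hc : RapidDecay c) (s : ℝ) :
    eNormSq s c < ∞ := by
  obtain ⟨m, hm⟩ := exists_nat_ge s
  refine (eNormSq_mono hm c).trans_lt (eNormSq_lt_top_of_summable ?_)
  set B : ℝ := ∑' l, ‖c l‖
  refine Summable.of_nonneg_of_le (fun k => by positivity) (fun k => ?_) ((hc m).mul_right B)
  rw [sobolevWeight_natCast_sq, sq, ← mul_assoc]
  exact mul_le_mul_of_nonneg_left (hc.norm_le_tsum k) (by positivity [one_le_one_add_freqNormSq k])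

/-- **The coefficients of a smooth function lie in every `H_s`** (Warner: "`𝒫 ⊂ H_s` for each
`s`", 6.17/6.18 (c)) — the tree's discharged fact `Torus.IsSmooth.memSobolev`
(`TorusSobolevNormSmoothProofs.lean`) read on the lattice. [cite: WarnerGTM94, 6.18 (c)] -/
theorem _root_.Literature.Analysis.FunctionSpaces.Torus.IsSmooth.eNormSq_mFourierCoeff_lt_top
    [NormedSpace ℂ V] {g : UnitAddTorus d → V} (hg : IsSmooth g) (s : ℝ) :
    eNormSq s (UnitAddTorus.mFourierCoeff g) < ∞ :=
  eNorm_lt_top_iff.1 (IsSmooth.memSobolev_holds hg s).2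

/-- **Warner's Sobolev lemma, lattice form**: a family lying in `H_m` for every natural `m` is
rapidly decreasing (Warner (1983), 6.22 and Cor. (a), there via Cauchy–Schwarz against
`∑(1+|ξ|²)^{-t}`; here `(1+|k|²)^m ‖c k‖ ≤ (1+|k|²)^{-2r} + (1+|k|²)^{2(m+r)} ‖c k‖²` with
`r = #d` and the tree's lattice sum `Torus.summable_inv_one_add_freqNormSq_pow_card`).
[cite: WarnerGTM94, 6.22] -/
theorem rapidDecay_of_forall_eNormSq_lt_top {c : (d → ℤ) → V} (h : ∀ m : ℕ, eNormSq m c < ∞) :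
    RapidDecay c := by
  intro m
  set r : ℕ := Fintype.card d
  have hsum1 : Summable fun k : d → ℤ => ((1 + freqNormSq k) ^ r)⁻¹ :=
    summable_inv_one_add_freqNormSq_pow_card
  have hsum2 : Summable fun k => (1 + freqNormSq k) ^ (2 * (m + r)) * ‖c k‖ ^ 2 := by
    have := summable_of_eNormSq_lt_top (h (2 * (m + r)))
    simpa only [Nat.cast_mul, Nat.cast_add, Nat.cast_ofNat, ← Nat.cast_ofNat (R := ℝ) (n := 2),
      ← Nat.cast_add, ← Nat.cast_mul, sobolevWeight_natCast_sq] using this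
  refine Summable.of_nonneg_of_le (fun k => by positivity [one_le_one_add_freqNormSq k])
    (fun k => ?_) (hsum1.add hsum2)
  -- AM–GM: `x y ≤ x² + y²` with `x = N^{-r}`, `y = N^{m+r} ‖c k‖`, and `x² ≤ N^{-r}` as `N ≥ 1`
  set N : ℝ := 1 + freqNormSq k
  have hN : 1 ≤ N := one_le_one_add_freqNormSq k
  have hNpos : 0 < N := by linarith
  have key : N ^ m * ‖c k‖ = (N ^ r)⁻¹ * (N ^ (m + r) * ‖c k‖) := by
    rw [pow_add]; field_simp
  rw [key]
  set x : ℝ := (N ^ r)⁻¹ with hxdef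
  set y : ℝ := N ^ (m + r) * ‖c k‖ with hydef
  have hx0 : 0 ≤ x := by positivity
  have hy0 : 0 ≤ y := by positivity
  have hx1 : x ≤ 1 := inv_le_one_of_one_le₀ (one_le_pow₀ hN)
  have hy2 : y ^ 2 = N ^ (2 * (m + r)) * ‖c k‖ ^ 2 := by
    rw [hydef, mul_pow, ← pow_mul, mul_comm (m + r) 2]
  calc x * y ≤ x ^ 2 + y ^ 2 := by nlinarith [sq_nonneg (x - y), mul_nonneg hx0 hy0]
    _ ≤ x + y ^ 2 := by nlinarith
    _ = x + N ^ (2 * (m + r)) * ‖c k‖ ^ 2 := by rw [hy2]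

/-- **`⋂_m H_m` = rapidly decreasing** (Warner 6.22 with 6.18 (c)). [cite: WarnerGTM94, 6.22] -/
theorem rapidDecay_iff_forall_eNormSq_lt_top {c : (d → ℤ) → V} :
    RapidDecay c ↔ ∀ m : ℕ, eNormSq m c < ∞ :=
  ⟨fun h m => eNormSq_lt_top_of_rapidDecay h m, rapidDecay_of_forall_eNormSq_lt_top⟩

/-- **Sobolev lemma, smooth form** (Warner (1983), 6.22 Cor. (a): "each `u ∈ H_t` for this range
of `t` corresponds to a function `∑ u_ξ e^{ix·ξ}` of class `C^m`", all `m`): a family lying in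
every `H_m` is the coefficient family of a (unique) smooth function on `T^d`, its Fourier
synthesis. [cite: WarnerGTM94, 6.22 Cor. (a)] -/
theorem exists_isSmooth_of_forall_eNormSq_lt_top [NormedSpace ℂ V] [CompleteSpace V] {c : (d → ℤ) → V}
    (h : ∀ m : ℕ, eNormSq m c < ∞) :
    ∃ g : UnitAddTorus d → V, IsSmooth g ∧ UnitAddTorus.mFourierCoeff g = c := by
  classical
  have hc := rapidDecay_of_forall_eNormSq_lt_top h
  exact ⟨fourierSynth c, hc.isSmooth_fourierSynth, funext hc.mFourierCoeff_fourierSynth⟩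

end Smooth

/-! ### Truncation to finitely many modes (Warner 6.20 (1), 6.18 (c)) -/

section Trunc

/-- **Truncation** of a coefficient family to a finite set of modes `K`: `(𝟙_K c)(k) = c k` for
`k ∈ K` and `0` otherwise (Warner (1983), 6.20 (1): "`u_N` the element of `H_s` obtained by
truncating `u` at `N`"; these are the trigonometric polynomials, dense in every `H_s`, 6.18 (c)).
[cite: WarnerGTM94, 6.20 (1)] -/
def trunc (K : Finset (d → ℤ)) (c : (d → ℤ) → V) : (d → ℤ) → V := fun k => if k ∈ K then c k else 0

/-- Unfolding of `trunc`. [folklore] -/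
@[simp] theorem trunc_apply (K : Finset (d → ℤ)) (c : (d → ℤ) → V) (k : d → ℤ) :
    trunc K c k = if k ∈ K then c k else 0 := rfl

/-- A truncation vanishes off `K`. [folklore] -/
theorem trunc_apply_of_not_mem {K : Finset (d → ℤ)} (c : (d → ℤ) → V) {k : d → ℤ} (hk : k ∉ K) :
    trunc K c k = 0 := if_neg hk

/-- Truncation is additive. [folklore] -/
theorem trunc_add (K : Finset (d → ℤ)) (c c' : (d → ℤ) → V) :
    trunc K (c + c') = trunc K c + trunc K c' := by
  funext k; by_cases hk : k ∈ K <;> simp [trunc, hk]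

/-- Truncation commutes with scalars. [folklore] -/
theorem trunc_smul {𝕜 : Type*} [SMulZeroClass 𝕜 V] (K : Finset (d → ℤ)) (a : 𝕜) (c : (d → ℤ) → V) :
    trunc K (a • c) = a • trunc K c := by
  funext k; by_cases hk : k ∈ K <;> simp [trunc, hk]

/-- **The norm of a truncation is a finite sum**: `‖𝟙_K c‖²_s = ∑_{k ∈ K} ⟨k⟩^{2s} ‖c k‖²`.
[cite: WarnerGTM94, 6.20] -/
theorem eNormSq_trunc (s : ℝ) (K : Finset (d → ℤ)) (c : (d → ℤ) → V) :
    eNormSq s (trunc K c) = ∑ k ∈ K, ENNReal.ofReal (sobolevWeight s k ^ 2) * ‖c k‖ₑ ^ 2 := by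
  rw [eNormSq, tsum_eq_sum (s := K) (fun k hk => by simp [trunc, hk])]
  exact Finset.sum_congr rfl fun k hk => by simp [trunc, hk]

/-- A truncation lies in every `H_s`. [folklore] -/
theorem eNormSq_trunc_lt_top (s : ℝ) (K : Finset (d → ℤ)) (c : (d → ℤ) → V) :
    eNormSq s (trunc K c) < ∞ := by
  rw [eNormSq_trunc]
  exact ENNReal.sum_lt_top.2 fun k _ => ENNReal.mul_lt_top ENNReal.ofReal_lt_top
    (ENNReal.pow_lt_top enorm_lt_top)

/-- `‖𝟙_K c‖²_s ≤ ‖c‖²_s`. [folklore] -/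
theorem eNormSq_trunc_le (s : ℝ) (K : Finset (d → ℤ)) (c : (d → ℤ) → V) :
    eNormSq s (trunc K c) ≤ eNormSq s c :=
  eNormSq_le_of_norm_le_norm fun k => by by_cases hk : k ∈ K <;> simp [trunc, hk]

/-- A truncation is rapidly decreasing (it is finitely supported), i.e. the coefficient family of a
trigonometric polynomial. [folklore] -/
theorem rapidDecay_trunc (K : Finset (d → ℤ)) (c : (d → ℤ) → V) :
    RapidDecay (trunc K c) := fun m =>
  summable_of_ne_finset_zero (s := K) fun k hk => by simp [trunc, hk]

/-- The remainder after truncation: `‖c - 𝟙_K c‖²_s = ∑_{k ∉ K} ⟨k⟩^{2s} ‖c k‖²` (as a sum of the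
indicator of `Kᶜ`). [folklore] -/
theorem eNormSq_sub_trunc (s : ℝ) (K : Finset (d → ℤ)) (c : (d → ℤ) → V) :
    eNormSq s (c - trunc K c) =
      ∑' k, (↑K : Set (d → ℤ))ᶜ.indicator
        (fun k => ENNReal.ofReal (sobolevWeight s k ^ 2) * ‖c k‖ₑ ^ 2) k := by
  refine tsum_congr fun k => ?_
  by_cases hk : k ∈ K
  · simp [trunc, hk]
  · simp [trunc, hk]

/-- **Truncations converge in `H_s`** (density of the trigonometric polynomials, Warner 6.18 (c)):
for `c ∈ H_s`, `‖c - 𝟙_K c‖²_s → 0` as the finite set `K` exhausts `ℤ^d`.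
[cite: WarnerGTM94, 6.18 (c)] -/
theorem tendsto_eNormSq_sub_trunc {s : ℝ} {c : (d → ℤ) → V} (h : eNormSq s c < ∞) :
    Tendsto (fun K : Finset (d → ℤ) => eNormSq s (c - trunc K c)) atTop (𝓝 0) := by
  have ht := ENNReal.tendsto_tsum_compl_atTop_zero
    (f := fun k => ENNReal.ofReal (sobolevWeight s k ^ 2) * ‖c k‖ₑ ^ 2) h.ne
  refine ht.congr fun K => ?_
  rw [eNormSq_sub_trunc, ← tsum_subtype]
  rfl

end Trunc

end Lattice

end Literature.Analysis.FunctionSpaces
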